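import Mathlib
import HarnessLib
import Summits.ResolutionOfSingularities.ResolutionOfSingularities.Theorems.WildQuotientsWildQuotientResolutionS1aValuative

/-!
# S1a — PRODUCERS OF CENTRED VALUATIONS: from a unit-reflecting hom out of the stalk, from sections of an affine open, from weighted orders of power series

[OURS · L1 W4.5c · lead-1 g9, SUCCESSOR-BRIEF-v1 §4 item 1 (D-VAL), the constructor kit] — NOT statements of the manuscript; counted 0; AI-level work,
weaker than expert review. Crux stmt-ResolutionOfSingularities-17941 (`WildQuotients.CyclicQuotientFourfolds`), line `s1a-logminvertex` v10 (attack forms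
`KillValReach`/`KillValMeetReach`/`AuxValAt` of `…S1aValuative`, `…S1aAuxValuative`). Route-independent; pure scheme/algebra level (no `G`).

How a census worker MAKES a `Valuative.CentredVal X x` (item (ii) of FRAME-STATUS rev9 §6):
* `CentredVal.ofLocalHom` — pull an `ℕ∞`-valued additive valuation `v` on a ring `S` (`v s = 0 → IsUnit s`) back along a UNIT-REFLECTING ring hom
  `φ : 𝒪_{X,x} →+* S`;
* `CentredVal.liftStalk` / `CentredVal.ofSections` — for an affine open `U ∋ x` and a ring hom `ψ : Γ(X, U) →+* S` with `IsUnit (ψ f) ↔ x ∈ D(f)`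
  ("`ψ` is centred at `x`"), lift `ψ` to the stalk (`IsAffineOpen.isLocalization_stalk`; `mem_primeIdealOf_iff`) — the lift is unit-reflecting
  (`isUnit_of_isUnit_liftStalk`); ★ `mem_valIdeal_ofSections_iff : f ∈ 𝒥ₙ(U) ↔ n ≤ v (ψ f)`;
* `weightedOrderVal w : AddValuation (MvPowerSeries σ k) ℕ∞` — Mathlibʼs weighted order (`weightedOrder_mul`, `min_weightedOrder_le_add`), with
  `isUnit_of_weightedOrder_eq_zero` for positive weights; ★★ `CentredVal.ofPowerSeries` (from `ψ : Γ(X, U) →+* MvPowerSeries σ k` centred at `x` and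
  positive weights `w`) with `mem_valIdeal_ofPowerSeries_iff : f ∈ 𝒥ₙ(U) ↔ n ≤ weightedOrder w (ψ f)` — the valuation ideals on the chart ARE the
  pull-backs of the weighted-order ideals, which is the shape of the filtration clause of `IsCentreChart` / `IsPrincipalCentreChart`.
-/

set_option linter.dupNamespace false

noncomputable section

universe u

open CategoryTheory Limits AlgebraicGeometry TopologicalSpace Topology Opposite
open Literature.AlgebraicGeometry.Resolution

namespace Summit.ResolutionOfSingularities.ResolutionOfSingularities.Theorems.WildQuotientResolution.S1.Valuative

/-! ## 1. The weighted-order valuation on multivariate power series -/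

section PowerSeries

variable {σ k : Type*} [Field k] (w : σ → ℕ)

/-- **The weighted order as an additive valuation** on `k⟦xᵢ : i ∈ σ⟧` with values in `ℕ∞` (Mathlib: `weightedOrder_mul` over a domain,
`min_weightedOrder_le_add`). [folklore; OURS packaging · L1 W4.5c] -/
def weightedOrderVal : AddValuation (MvPowerSeries σ k) ℕ∞ :=
  AddValuation.of (MvPowerSeries.weightedOrder w) (MvPowerSeries.weightedOrder_zero w) (MvPowerSeries.weightedOrder_one w)
    (fun _ _ => MvPowerSeries.min_weightedOrder_le_add w) (MvPowerSeries.weightedOrder_mul w)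

/-- Unfolding. -/
@[simp] theorem weightedOrderVal_apply (f : MvPowerSeries σ k) : weightedOrderVal w f = f.weightedOrder w := rfl

/-- With POSITIVE weights, weighted order `0` means a non-zero constant coefficient, i.e. a unit. -/
theorem isUnit_of_weightedOrder_eq_zero (hw : ∀ i, 0 < w i) {f : MvPowerSeries σ k} (h : f.weightedOrder w = 0) : IsUnit f := by
  obtain ⟨⟨d, hd, hwd⟩, -⟩ := (MvPowerSeries.weightedOrder_eq_nat w (f := f) (n := 0)).1 (by rw [h]; rfl)
  have hd0 : d = 0 := by
    ext s
    by_contra hs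
    have h1 : w s ≤ Finsupp.weight w d := Finsupp.le_weight_of_ne_zero' w hs
    rw [hwd] at h1
    exact (hw s).ne' (Nat.le_zero.1 h1)
  subst hd0
  exact MvPowerSeries.isUnit_iff_constantCoeff.2 (isUnit_iff_ne_zero.2 (by simpa using hd))

end PowerSeries

/-! ## 2. Centred valuations from unit-reflecting homs out of the stalk -/

namespace CentredVal

variable {X : Scheme.{u}}

/-- **Pull back along a unit-reflecting hom**: `φ : 𝒪_{X,ξ} →+* S` reflecting units and `v` on `S` vanishing only on units give a valuation
centred at `ξ`. [OURS · L1 W4.5c] -/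
def ofLocalHom {ξ : X} {S : Type*} [CommRing S] (φ : X.presheaf.stalk ξ →+* S) (hφ : ∀ f, IsUnit (φ f) → IsUnit f)
    (v : AddValuation S ℕ∞) (hv : ∀ s, v s = 0 → IsUnit s) : CentredVal X ξ where
  v := v.comap φ
  isUnit_of_map_eq_zero f hf := hφ f (hv (φ f) hf)

/-- Unfolding. -/
@[simp] theorem ofLocalHom_v_apply {ξ : X} {S : Type*} [CommRing S] (φ : X.presheaf.stalk ξ →+* S) (hφ : ∀ f, IsUnit (φ f) → IsUnit f)
    (v : AddValuation S ℕ∞) (hv : ∀ s, v s = 0 → IsUnit s) (f : X.presheaf.stalk ξ) : (ofLocalHom φ hφ v hv).v f = v (φ f) := rfl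

/-! ## 3. From sections of an affine open: lifting a hom centred at `x` to the stalk -/

variable {U : X.Opens} (hU : IsAffineOpen U) (x : U)

/-- The prime of `Γ(X, U)` at `x` consists of the sections vanishing at `x`. [folklore] -/
theorem mem_primeIdealOf_iff (f : Γ(X, U)) : f ∈ (hU.primeIdealOf x).asIdeal ↔ (x : X) ∉ X.basicOpen f := by
  rw [hU.primeIdealOf_eq_map_closedPoint x, Spec.map_apply, PrimeSpectrum.comap_asIdeal, Ideal.mem_comap,
    show (IsLocalRing.closedPoint (X.presheaf.stalk (x : X))).asIdeal = IsLocalRing.maximalIdeal _ from rfl,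
    IsLocalRing.mem_maximalIdeal, mem_nonunits_iff, Scheme.mem_basicOpen X f x x.2]

/-- Sections outside the prime at `x` do not vanish at `x`. -/
theorem mem_basicOpen_of_mem_primeCompl (y : (hU.primeIdealOf x).asIdeal.primeCompl) : (x : X) ∈ X.basicOpen (y : Γ(X, U)) := by
  have hy : (y : Γ(X, U)) ∉ (hU.primeIdealOf x).asIdeal := show (y : Γ(X, U)) ∉ ((hU.primeIdealOf x).asIdeal : Set Γ(X, U)) from y.2
  exact not_not.1 ((mem_primeIdealOf_iff hU x y.1).not.1 hy)

variable {S : Type*} [CommRing S] (ψ : Γ(X, U) →+* S)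

/-- **Lift of a hom inverting the sections not vanishing at `x` to the stalk `𝒪_{X,x}`** (`IsAffineOpen.isLocalization_stalk`). [OURS · L1 W4.5c] -/
def liftStalk (hψ : ∀ f : Γ(X, U), (x : X) ∈ X.basicOpen f → IsUnit (ψ f)) : X.presheaf.stalk (x : X) →+* S :=
  letI := hU.isLocalization_stalk x
  IsLocalization.lift (M := (hU.primeIdealOf x).asIdeal.primeCompl) (S := X.presheaf.stalk (x : X)) (g := ψ)
    fun y => hψ y.1 (mem_basicOpen_of_mem_primeCompl hU x y)

/-- The lift on germs is `ψ`. -/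
@[simp] theorem liftStalk_germ (hψ : ∀ f : Γ(X, U), (x : X) ∈ X.basicOpen f → IsUnit (ψ f)) (f : Γ(X, U)) :
    liftStalk hU x ψ hψ ((X.presheaf.germ U x x.2).hom f) = ψ f := by
  letI := hU.isLocalization_stalk x
  exact IsLocalization.lift_eq (M := (hU.primeIdealOf x).asIdeal.primeCompl) _ f

/-- If `ψ` moreover DETECTS `x` (`IsUnit (ψ f) → x ∈ D(f)`), the lift reflects units. -/
theorem isUnit_of_isUnit_liftStalk (hψ : ∀ f : Γ(X, U), (x : X) ∈ X.basicOpen f → IsUnit (ψ f))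
    (hψ' : ∀ f : Γ(X, U), IsUnit (ψ f) → (x : X) ∈ X.basicOpen f) (φ : X.presheaf.stalk (x : X)) (h : IsUnit (liftStalk hU x ψ hψ φ)) :
    IsUnit φ := by
  letI := hU.isLocalization_stalk x
  obtain ⟨⟨a, s⟩, e⟩ := IsLocalization.surj (hU.primeIdealOf x).asIdeal.primeCompl φ
  have e' : φ * (X.presheaf.germ U x x.2).hom s = (X.presheaf.germ U x x.2).hom a := e
  have ha : IsUnit (ψ a) := by
    have h2 := congrArg (liftStalk hU x ψ hψ) e'
    rw [map_mul, liftStalk_germ, liftStalk_germ] at h2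
    rw [← h2]
    exact h.mul (hψ s.1 (mem_basicOpen_of_mem_primeCompl hU x s))
  have ha' : IsUnit ((X.presheaf.germ U x x.2).hom a) := (Scheme.mem_basicOpen X a x x.2).1 (hψ' a ha)
  rw [← e'] at ha'
  exact isUnit_of_mul_isUnit_left ha'

/-- ★ **A centred valuation from sections**: `ψ : Γ(X, U) →+* S` CENTRED at `x` (`IsUnit (ψ f) ↔ x ∈ D(f)`) and `v` on `S` vanishing only on units.
[OURS · L1 W4.5c] -/
def ofSections (hψ : ∀ f : Γ(X, U), IsUnit (ψ f) ↔ (x : X) ∈ X.basicOpen f) (v : AddValuation S ℕ∞) (hv : ∀ s, v s = 0 → IsUnit s) :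
    CentredVal X (x : X) :=
  ofLocalHom (liftStalk hU x ψ fun f h => (hψ f).2 h) (isUnit_of_isUnit_liftStalk hU x ψ (fun f h => (hψ f).2 h) fun f h => (hψ f).1 h) v hv

/-- On germs of sections of `U` the valuation is `v ∘ ψ`. -/
@[simp] theorem ofSections_v_germ (hψ : ∀ f : Γ(X, U), IsUnit (ψ f) ↔ (x : X) ∈ X.basicOpen f) (v : AddValuation S ℕ∞)
    (hv : ∀ s, v s = 0 → IsUnit s) (f : Γ(X, U)) : (ofSections hU x ψ hψ v hv).v ((X.presheaf.germ U x x.2).hom f) = v (ψ f) := by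
  rw [ofSections, ofLocalHom_v_apply, liftStalk_germ]

/-- ★ **The valuation ideals on `U` are the pull-backs of the value ideals of `v` along `ψ`.** [OURS · L1 W4.5c] -/
theorem mem_valIdeal_ofSections_iff (hψ : ∀ f : Γ(X, U), IsUnit (ψ f) ↔ (x : X) ∈ X.basicOpen f) (v : AddValuation S ℕ∞)
    (hv : ∀ s, v s = 0 → IsUnit s) {n : ℕ} (f : Γ(X, U)) :
    f ∈ (ofSections hU x ψ hψ v hv).valIdeal n ⟨U, hU⟩ ↔ (n : ℕ∞) ≤ v (ψ f) := by
  rw [mem_valIdeal_iff]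
  constructor
  · intro h
    rw [← ofSections_v_germ hU x ψ hψ v hv f]
    exact h x.2
  · intro h _
    rw [ofSections_v_germ]
    exact h

/-! ## 4. From a power-series expansion centred at `x` with positive weights -/

/-- ★★ **A centred valuation from a power-series expansion**: `ψ : Γ(X, U) →+* k⟦x_σ⟧` centred at `x` and positive weights `w` give the valuation
"weighted order of the expansion" centred at `x`. [OURS · L1 W4.5c] -/
def ofPowerSeries {σ k : Type*} [Field k] (ψ : Γ(X, U) →+* MvPowerSeries σ k) (hψ : ∀ f : Γ(X, U), IsUnit (ψ f) ↔ (x : X) ∈ X.basicOpen f)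
    (w : σ → ℕ) (hw : ∀ i, 0 < w i) : CentredVal X (x : X) :=
  ofSections hU x ψ hψ (weightedOrderVal w) fun _ hs => isUnit_of_weightedOrder_eq_zero w hw hs

/-- ★★ **The valuation ideals of a power-series valuation on its chart**: `f ∈ 𝒥ₙ(U) ↔ n ≤ weightedOrder w (ψ f)`. [OURS · L1 W4.5c] -/
theorem mem_valIdeal_ofPowerSeries_iff {σ k : Type*} [Field k] (ψ : Γ(X, U) →+* MvPowerSeries σ k)
    (hψ : ∀ f : Γ(X, U), IsUnit (ψ f) ↔ (x : X) ∈ X.basicOpen f) (w : σ → ℕ) (hw : ∀ i, 0 < w i) {n : ℕ} (f : Γ(X, U)) :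
    f ∈ (ofPowerSeries hU x ψ hψ w hw).valIdeal n ⟨U, hU⟩ ↔ (n : ℕ∞) ≤ (ψ f).weightedOrder w :=
  mem_valIdeal_ofSections_iff hU x ψ hψ _ _ f

/-- On germs of sections of `U` the power-series valuation is the weighted order of the expansion. -/
theorem ofPowerSeries_v_germ {σ k : Type*} [Field k] (ψ : Γ(X, U) →+* MvPowerSeries σ k)
    (hψ : ∀ f : Γ(X, U), IsUnit (ψ f) ↔ (x : X) ∈ X.basicOpen f) (w : σ → ℕ) (hw : ∀ i, 0 < w i) (f : Γ(X, U)) :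
    (ofPowerSeries hU x ψ hψ w hw).v ((X.presheaf.germ U x x.2).hom f) = (ψ f).weightedOrder w :=
  ofSections_v_germ hU x ψ hψ _ _ f

end CentredVal

end Summit.ResolutionOfSingularities.ResolutionOfSingularities.Theorems.WildQuotientResolution.S1.Valuative

end
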